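import Literature.MathematicalPhysics.QuantumFieldTheory.Balaban1983to89.B8Thm4CoreZdGF3HPLanEGamma
import Literature.MathematicalPhysics.QuantumFieldTheory.Balaban1983to89.B8Thm8SurvivingZd3H
import Literature.MathematicalPhysics.QuantumFieldTheory.Balaban1983to89.B8LeafModelZd3P2

/-!
# `Balaban1983to89.B8Thm8SurvivingZdGF3HP2MapLanEGamma` — [Balaban1985RegularSpaces] THEOREM 8 (p. 101), SURVIVING FORM, ON THE `Ω₀ = ℤᵈ` MEMBERS OF THE
# EDITION-δ₂ P-CARRIER `B8LeafModelZd3P2.zdGF3HP₂` (the Hölder member of (1.36) «on Ω_j») OVER AN ARBITRARY INDEX MAP — D7-3(C)₂, the token-swap twin of this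
# seat's D7-3(C) `B8Thm8SurvivingZdGF3HPMapLanEGamma` (p593018); its Theorem-4 core is the UNCHANGED `B8Thm4CoreZdGF3HPLanEGamma.thm4Core_zdGF3HP_map_lanE_γ'`
# (Theorem 4 does not read (1.36): the two editions' `GFData` letters it reads are `rfl`-equal)

statement-level skeleton of published theorems with citation tags; proofs where landed; nothing here is a claim about the Yang–Mills mass gap

T. Bałaban, *Spaces of regular gauge field configurations on a lattice and gauge fixing conditions*, Commun. Math. Phys. **99** (1985) 75–102
`[Balaban1985RegularSpaces]` ("B8"): Thm 8 (1.146) p. 101, Thm 4 p. 88, Thm 2 p. 83, Prop. 3 p. 87 ((1.61), (1.65)–(1.66)), Prop. 5 p. 94, (1.29) p. 81, (1.31) p. 82,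
(1.35) p. 82, (1.36)–(1.38) p. 82 («on Ω_j»), (1.42) p. 83, (1.62) p. 87, p. 77; [4] = [Balaban1985BackgroundPropagators] Thm 3.3 p. 398, (3.40) p. 397.
PDF held: `paper:balaban1985-cmp99-regular-spaces-gauge-fixing` (journal page = PDF page + 74).

CITATION HEADER (lean-in-tree rule).  Cell `pub-ymgap` (HUMAN RULING D-0062, Track A), DAG node N05 = [B8], seat `pub-ymgap-dag-n05-d` (g11; R134 row s2).
WHY THIS FILE.  LOCATED NARROWNESS №4 (cell bus 2026-08-28): `B8Thm8Surviving.Thm8SurvivingAt` READS `C136` (conclusion under the inspected source size, and the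
uniqueness antecedent), so Theorem 8's surviving form must be re-run on the edition-δ₂ carrier `zdGF3HP₂` (this seat's `B8LeafModelZd3P2`, p599986) whose Hölder
member is printed's «on Ω_j».  THIS FILE is D7-3(C) token for token with `zdGF3HP ↦ zdGF3HP₂` in the statement and the sourced Proposition-3 hypothesis `SP3src` read
on `zdGF3HP₂` (its Hölder clause on Ω_j × Ω_j pairs — the conclusion of this seat's `B8Prop3SrcZd3HP2Gamma`); the proof is UNCHANGED: the Theorem-4 core
`thm4Core_zdGF3HP_map_lanE_γ'` and every other callee read only `rfl`-equal letters, and the uniqueness clause uses the first member of `C136` only.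
Generator `gen_p2twins.py` on the tree bytes of D7-3(C).

WHAT THIS FILE PROVES (one theorem, no `def`).
★★ `thm8SurvivingAt_zdGF3HP₂_map_lanE_γ'` — `B8Thm8Surviving.Thm8SurvivingAt γ (5dL·B₈·(1+11d²)) (5dL·B₀β·(1+11d²)) (fun a => zdGF3HP₂ 𝔸 L β len (ι a))` for any `ι`
into the `Ω 0 = univ` members with the tower law at every truncation, MODULO `SP5base` ∕ `SP5` ∕ `SH59src` ∕ `SP5u`(E) (γ′ letters) ∕ `SP3src` (on `zdGF3HP₂`) AT `ι a`
with the ρ2 source premiss.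

HONEST SCOPE.  Re-keying ∕ assembly BY NAME: Proposition 5 (both halves, sourced), the sourced b9 socket and the sourced Proposition 3 remain HYPOTHESES (at `ι a`);
no estimate is proved here beyond the cited assembly; constants unchanged; `≤` where print has `<`; `T_η ↦ ℤᵈ`.  Count-neutral; N05 NOT discharged; one finite `T⁴`
programme at fixed `ε`; nothing continuum ∕ ℝ⁴ ∕ OS ∕ mass-gap ∕ Clay.  No `sorry`, no `def`, no `instance`, no `notation`.  Unit `pub-ymgap-dag-n05-d` (g11), 2026-08-28.
-/

noncomputable section

open NormedSpace

namespace Literature.MathematicalPhysics.QuantumFieldTheory.Balaban1983to89.B8Thm8SurvivingZdGF3HP2MapLanEGamma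

open Complex (I)
open MatrixLog B7Prop1Explicit B7Prop2Explicit B7Prop1Local B7Eq92Concrete
open B7Prop2Explicit (C0 c2')
open B7Prop3Flat (c3)
open B8Ineq132 (covDerivFwd InAk BondTouches)
open B8Eq119TwistedAxial (Restr129 InAx)
open B8Eq184Proof (gaugeExp cfgExp)
open B8Lemma1NonAbelian (mulCfg)
open B8Eq140Level (SideTouches)
open B8Eq146AExpansion (iEta)
open B7Prop4GeneralLevels (logCovIter linCovIter)
open B8Eq155JBound (Jcur wsup)
open B8ScaledSupNorm (bondNorm msup)
open B8Thm2LogB (blockTop)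
open B8Ineq130 (tlo thi)
open B8Eq138LandauZd (IsLandau146W InR138 logCfg)
open B8Thm4Windows (thm4_windows thm4_windows_extra)
open B8Thm4ExistsConcreteGamma (thm4_windows_γ)
open B8LeafModelZd (ZdIdx)
open B8LeafModelZd3 (zdGF3)
open B8LeafModelZd3P (zdGF3P zdGF3HP)
open B8LeafModelZd3P2 (zdGF3P₂ zdGF3HP₂)
open B8TowerBondsPrinted (towerBondsP)
open B8ScaledSupNorm (Bdd)
open B8Ineq166Univ (norm_pert_sub_one_le_univ)
open B8Thm4CoreZdGF3HPLanEGamma (thm4Core_zdGF3HP_map_lanE_γ')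

-- `Site` alone could resolve to the torus sites of `Setup.lean`; re-export the `ℤ^d` sites of `B7Prop1Explicit`.
export B7Prop1Explicit (Site)

variable {d : ℕ}

/-! ## Theorem 8 surviving on `zdGF3HP ∘ ι`, E currency, edition γ′ -/

section Thm8

variable {𝔸 : Type} [CStarAlgebra 𝔸] [Nontrivial 𝔸]

/-- ★★ **THEOREM 8 IN ITS SURVIVING FORM ON THE `Ω₀ = ℤᵈ` MEMBERS OF THE P-CARRIER `zdGF3HP`, OVER AN INDEX MAP, MODULO THE SOURCED SOCKETS AT `ι a` (EDITION γ′)** —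
`B8Thm8SurvivingZd3MapHE.thm8SurvivingAt_zd3H_map_lanE` RE-RUN on dag-n05-w1's P-carrier (`B8LeafModelZd3P.zdGF3HP`: (1.35) ∕ (1.66) in print's one-end-point class,
(1.37) ∕ (1.42) over print's class `towerBondsP` of the member's tower, Theorem 8's «`f ∈ R(U₀)`» as printed): for any `ι : J → ZdIdx d L` onto `Ω₀ = ℤᵈ` members
obeying the tower law at every truncation, `B8Thm8Surviving.Thm8SurvivingAt γ (5dL·B₈·(1+11d²)) (5dL·B₀β·(1+11d²)) (zdGF3HP ∘ ι)` MODULO the five sourced sockets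
demanded `∀ a : J` AT `ι a` ONLY — `SP5base` ∕ `SP5` ∕ `SH59src` ∕ `SP5u` in the γ′ letters (one-end-point (1.35) antecedent; `|B₁|` over `towerBondsP`) and the
sourced Proposition 3 `SP3src` ON THE P-CARRIER with the γ edition's (1.61) «`2α₂² + 20dα₀α₂ + 2C₂α₂² ≤ α₀ + α₁`, `C₂ = 2097152(d+1)²L²`» (provider: this seat's
`B8Prop3SrcZd3HPGamma.sp3src_zdGF3HP_map_of_sockB9P3srcHP_γ`).  Proof = the original's verbatim with: core `B8Thm4CoreZdGF3HPLanEGamma.thm4Core_zdGF3HP_map_lanE_γ'`;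
the γ windows `B8Thm4ExistsConcreteGamma.thm4_windows_γ` at the shifted pair `(α₀, α″ := 11d²(α₀+α₁) + α₁)` for (1.61) and for (1.37); (1.37) at the ORIGINAL `α₁` by
dag-n05-w2's `B8Eq142KLevelLocalGammaPrime.H42_of_inAx_γ'` (print's class, one-end-point (1.35), tower law at the truncation); (1.65) ⇒ (1.66)₀ by `B8Ineq166Univ`
on the box form, which the one-end-point letter contains (`B8LeafModelZd3P.endBlockIn_of_box`).  Constants unchanged.
[cite: Balaban1985RegularSpaces, Thm 8 (1.146) p.101, Thm 2 p.83, Thm 4 p.88, Prop. 3 p.87, (1.61) p.87, (1.65)–(1.66) pp.87–88, (1.42) p.83, (1.31) p.82, (1.35) p.82, p.77] -/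
theorem thm8SurvivingAt_zdGF3HP₂_map_lanE_γ' (hd2 : 2 ≤ d) {L : ℕ} (hL : 2 ≤ L) {β : ℝ} {len : Site d → ℝ}
    {B₀ B₀' B₀β cu cP cP3 γ γ' B₈ : ℝ} (hB₀ : 0 < B₀) (hB₀' : 0 < B₀') (hcu : 0 < cu) (hcP : 0 < cP) (hcP3 : 0 < cP3)
    (hγ : 0 < γ) (hγ' : 0 ≤ γ') (hB₈ : 0 < B₈) (hB₀8 : B₀ ≤ B₈) (hB : 2 ≤ 5 * (d : ℝ) * L * B₈)
    (hγB : 5 * (d : ℝ) * L * B₀ + 2 * (γ' * B₀) ≤ 5 * (d : ℝ) * L * B₈)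
    {J : Type} (ι : J → ZdIdx d L) (hΩ0 : ∀ a : J, (ι a).Ω 0 = Set.univ)
    -- the tower law at EVERY truncation of every member ((1.5)–(1.6) p. 77; `IdxB8Sub.tower_all` at the law members)
    (htw : ∀ a : J, ∀ m, m ≤ (ι a).k → ∀ j, j ≤ m → ∀ y ∈ (ι a).Λs m j, ∀ x, InBox (tlo L y j) (thi L y j) x → x ∈ (ι a).Ω j)
    (LanF : J → (Site d → Fin d → 𝔸ˣ) → (Site d → 𝔸) → ℕ → (Site d → Fin d → 𝔸ˣ) → Prop)
    (hLanF : ∀ (a : J) (U₀ : Site d → Fin d → 𝔸ˣ) (f : Site d → 𝔸) (W : Site d → Fin d → 𝔸ˣ),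
      LanF a U₀ f (ι a).k W ↔ IsLandau146W L (ι a).k (ι a).η ((ι a).Ω 0) ((ι a).Λs (ι a).k) U₀ f W)
    (SP5base : ∀ a : J, ∀ α₀ α₁ : ℝ, 0 < α₀ → 0 < α₁ → α₀ + α₁ ≤ cP →
      ∀ U₀ U' : Site d → Fin d → 𝔸ˣ, (∀ x κ, U₀ x κ ∈ unitaryUnits 𝔸) → (∀ x κ, U' x κ ∈ unitaryUnits 𝔸) →
      ∀ φ : Site d → 𝔸, ((InR138 L (ι a).k (ι a).η ((ι a).Ω 0) ((ι a).Λs (ι a).k) U₀ φ ∧ (∀ x, IsSelfAdjoint (φ x)) ∧ (∀ x, x ∉ (ι a).Ω 0 → φ x = 0) ∧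
          Bdd L (ι a).k (ι a).η (-(2 : ℝ)) (fun j (x : Site d) => x ∈ (ι a).Ω j) φ) ∧
        msup L (ι a).k (ι a).η (-(2 : ℝ)) (fun j (x : Site d) => x ∈ (ι a).Ω j) φ < γ * (α₀ + α₁)) →
      InAk L (ι a).k (ι a).η α₀ (ι a).Ω U₀ → InAk L (ι a).k (ι a).η α₀ (ι a).Ω (mulCfg U' U₀) → (∀ m, m ≤ (ι a).k → InAx L m ((ι a).Λs m) U₀ (mulCfg U' U₀)) →
      (∀ j, j ≤ (ι a).k → ∀ (z : Site d) (μ : Fin d),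
        ((∀ x, InBox (tlo L z j) (thi L z j) x → x ∈ (ι a).Ω j) ∨ (∀ x, InBox (tlo L (z + e μ) j) (thi L (z + e μ) j) x → x ∈ (ι a).Ω j)) →
        ‖(avgIter L (mulCfg U' U₀) j z μ : 𝔸) - (avgIter L U₀ j z μ : 𝔸)‖ ≤ α₁) →
      (∀ b ∈ {b : Site d × Fin d | SideTouches ((ι a).Ω 0) b.1 b.2}, ‖((U' b.1 b.2 : 𝔸ˣ) : 𝔸) - 1‖ ≤ α₁) →
      (∃ (v : Site d → 𝔸ˣ) (lam : Site d → 𝔸), (∀ x, v x ∈ unitaryUnits 𝔸) ∧ (∀ x, x ∉ (ι a).Ω 0 → v x = 1) ∧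
        (∀ j, j ≤ 1 → ∀ b ∈ {b : Site d × Fin d | SideTouches ((ι a).Ω j) b.1 b.2}, (v b.1 : 𝔸) = ((gaugeExp lam b.1 : 𝔸ˣ) : 𝔸) ∧
        (v (b.1 + e b.2) : 𝔸) = ((gaugeExp lam (b.1 + e b.2) : 𝔸ˣ) : 𝔸)) ∧
        (∀ j, j ≤ 1 → ∀ b ∈ {b : Site d × Fin d | SideTouches ((ι a).Ω j) b.1 b.2},
        ‖lam b.1‖ ≤ (8 * B₀' * (5 * (d : ℝ) * L * B₈) * (α₀ + α₁)) ∧ ((L : ℝ) ^ j * (ι a).η) * ‖covDerivFwd (ι a).η U₀ b.2 lam b.1‖ ≤ (8 * B₀' * (5 * (d : ℝ) * L * B₈) * (α₀ + α₁))) ∧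
        LanF a U₀ φ 1 (mgauge U₀ v⁻¹ U') ∧ Restr129 L 1 ((ι a).Λs 1) U₀ ((1 : Site d → 𝔸ˣ) * v)))
    (SP5 : ∀ a : J, ∀ α₀ α₁ : ℝ, 0 < α₀ → 0 < α₁ → α₀ + α₁ ≤ cP →
      ∀ U₀ U' : Site d → Fin d → 𝔸ˣ, (∀ x κ, U₀ x κ ∈ unitaryUnits 𝔸) → (∀ x κ, U' x κ ∈ unitaryUnits 𝔸) →
      ∀ φ : Site d → 𝔸, ((InR138 L (ι a).k (ι a).η ((ι a).Ω 0) ((ι a).Λs (ι a).k) U₀ φ ∧ (∀ x, IsSelfAdjoint (φ x)) ∧ (∀ x, x ∉ (ι a).Ω 0 → φ x = 0) ∧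
          Bdd L (ι a).k (ι a).η (-(2 : ℝ)) (fun j (x : Site d) => x ∈ (ι a).Ω j) φ) ∧
        msup L (ι a).k (ι a).η (-(2 : ℝ)) (fun j (x : Site d) => x ∈ (ι a).Ω j) φ < γ * (α₀ + α₁)) →
      InAk L (ι a).k (ι a).η α₀ (ι a).Ω U₀ → InAk L (ι a).k (ι a).η α₀ (ι a).Ω (mulCfg U' U₀) → (∀ m, m ≤ (ι a).k → InAx L m ((ι a).Λs m) U₀ (mulCfg U' U₀)) →
      (∀ j, j ≤ (ι a).k → ∀ (z : Site d) (μ : Fin d),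
        ((∀ x, InBox (tlo L z j) (thi L z j) x → x ∈ (ι a).Ω j) ∨ (∀ x, InBox (tlo L (z + e μ) j) (thi L (z + e μ) j) x → x ∈ (ι a).Ω j)) →
        ‖(avgIter L (mulCfg U' U₀) j z μ : 𝔸) - (avgIter L U₀ j z μ : 𝔸)‖ ≤ α₁) →
      (∀ b ∈ {b : Site d × Fin d | SideTouches ((ι a).Ω 0) b.1 b.2}, ‖((U' b.1 b.2 : 𝔸ˣ) : 𝔸) - 1‖ ≤ α₁) →
      (∀ m, 1 ≤ m → m < (ι a).k → ∀ (u₁ : Site d → 𝔸ˣ) (U₁ : Site d → Fin d → 𝔸ˣ) (A : Site d → Fin d → 𝔸),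
        (∀ x, u₁ x ∈ unitaryUnits 𝔸) → (∀ x, x ∉ (ι a).Ω 0 → u₁ x = 1) → mgauge U₀ u₁ U₁ = U' → Restr129 L m ((ι a).Λs m) U₀ u₁ →
        LanF a U₀ φ m U₁ →
        (∀ j, j ≤ m → ∀ b ∈ {b : Site d × Fin d | SideTouches ((ι a).Ω j) b.1 b.2},
        U₁ b.1 b.2 = cfgExp (ι a).η A b.1 b.2 ∧ IsSelfAdjoint (A b.1 b.2) ∧ ‖A b.1 b.2‖ ≤ (5 * (d : ℝ) * L * B₈ * (α₀ + α₁)) * ((L : ℝ) ^ j * (ι a).η)⁻¹) →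
        ∃ (v : Site d → 𝔸ˣ) (lam : Site d → 𝔸), (∀ x, v x ∈ unitaryUnits 𝔸) ∧ (∀ x, x ∉ (ι a).Ω 0 → v x = 1) ∧
        (∀ j, j ≤ m + 1 → ∀ b ∈ {b : Site d × Fin d | SideTouches ((ι a).Ω j) b.1 b.2}, (v b.1 : 𝔸) = ((gaugeExp lam b.1 : 𝔸ˣ) : 𝔸) ∧
        (v (b.1 + e b.2) : 𝔸) = ((gaugeExp lam (b.1 + e b.2) : 𝔸ˣ) : 𝔸)) ∧
        (∀ j, j ≤ m + 1 → ∀ b ∈ {b : Site d × Fin d | SideTouches ((ι a).Ω j) b.1 b.2},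
        ‖lam b.1‖ ≤ (8 * B₀' * (5 * (d : ℝ) * L * B₈) * (α₀ + α₁)) ∧ ((L : ℝ) ^ j * (ι a).η) * ‖covDerivFwd (ι a).η U₀ b.2 lam b.1‖ ≤ (8 * B₀' * (5 * (d : ℝ) * L * B₈) * (α₀ + α₁))) ∧
        LanF a U₀ φ (m + 1) (mgauge U₀ v⁻¹ U₁) ∧ Restr129 L (m + 1) ((ι a).Λs (m + 1)) U₀ (u₁ * v)))
    (SH59src : ∀ a : J, ∀ α₀ α₁ : ℝ, 0 < α₀ → 0 < α₁ → α₀ + α₁ ≤ cP →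
      ∀ U₀ U' : Site d → Fin d → 𝔸ˣ, (∀ x κ, U₀ x κ ∈ unitaryUnits 𝔸) → (∀ x κ, U' x κ ∈ unitaryUnits 𝔸) →
      ∀ φ : Site d → 𝔸, ((InR138 L (ι a).k (ι a).η ((ι a).Ω 0) ((ι a).Λs (ι a).k) U₀ φ ∧ (∀ x, IsSelfAdjoint (φ x)) ∧ (∀ x, x ∉ (ι a).Ω 0 → φ x = 0) ∧
          Bdd L (ι a).k (ι a).η (-(2 : ℝ)) (fun j (x : Site d) => x ∈ (ι a).Ω j) φ) ∧
        msup L (ι a).k (ι a).η (-(2 : ℝ)) (fun j (x : Site d) => x ∈ (ι a).Ω j) φ < γ * (α₀ + α₁)) →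
      InAk L (ι a).k (ι a).η α₀ (ι a).Ω U₀ → InAk L (ι a).k (ι a).η α₀ (ι a).Ω (mulCfg U' U₀) → (∀ m, m ≤ (ι a).k → InAx L m ((ι a).Λs m) U₀ (mulCfg U' U₀)) →
      (∀ j, j ≤ (ι a).k → ∀ (z : Site d) (μ : Fin d),
        ((∀ x, InBox (tlo L z j) (thi L z j) x → x ∈ (ι a).Ω j) ∨ (∀ x, InBox (tlo L (z + e μ) j) (thi L (z + e μ) j) x → x ∈ (ι a).Ω j)) →
        ‖(avgIter L (mulCfg U' U₀) j z μ : 𝔸) - (avgIter L U₀ j z μ : 𝔸)‖ ≤ α₁) →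
      (∀ b ∈ {b : Site d × Fin d | SideTouches ((ι a).Ω 0) b.1 b.2}, ‖((U' b.1 b.2 : 𝔸ˣ) : 𝔸) - 1‖ ≤ α₁) →
      (∀ m, 1 ≤ m → m ≤ (ι a).k → ∀ (u : Site d → 𝔸ˣ) (W : Site d → Fin d → 𝔸ˣ) (A' : Site d → Fin d → 𝔸),
        (∀ x, u x ∈ unitaryUnits 𝔸) → mgauge U₀ u W = U' → Restr129 L m ((ι a).Λs m) U₀ u → LanF a U₀ φ m W →
        (∀ y τ, IsSelfAdjoint (A' y τ)) →
        (∀ j, j ≤ m → ∀ y τ, SideTouches ((ι a).Ω j) y τ →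
        W y τ = cfgExp (ι a).η A' y τ ∧ ‖A' y τ‖ ≤ (2 * (L * (5 * (d : ℝ) * L * B₈ * (α₀ + α₁))) + 8 * (8 * B₀' * (5 * (d : ℝ) * L * B₈) * (α₀ + α₁))) * ((L : ℝ) ^ j * (ι a).η)⁻¹) →
        (∀ y τ, (∀ j, j ≤ m → ¬ SideTouches ((ι a).Ω j) y τ) → A' y τ = 0) →
        msup L m (ι a).η (-(1 : ℝ)) (fun j (b : Site d × Fin d) => SideTouches ((ι a).Ω j) b.1 b.2) (fun b => A' b.1 b.2)
        ≤ B₀ * (bondNorm L m (ι a).η (-(3 : ℝ)) (ι a).Ω (fun x μ => Jcur (ι a).η U₀ A' μ x)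
        + wsup 1 (fun p : {p : ℕ × (Site d × Fin d) // p.1 ≤ m ∧ p.2 ∈ towerBondsP L (ι a).Ω ((ι a).Λs m) p.1} =>
        linCovIter L U₀ (iEta (ι a).η A') p.1.1 p.1.2.1 p.1.2.2)) + γ' * B₀ * (α₀ + α₁) ∧
        msup L m (ι a).η (-(2 : ℝ)) (fun j (t : Fin d × Fin d × Site d) => SideTouches ((ι a).Ω j) t.2.2 t.2.1)
        (fun t => covDerivFwd (ι a).η U₀ t.1 (fun z => A' z t.2.1) t.2.2)
        ≤ B₀ * (bondNorm L m (ι a).η (-(3 : ℝ)) (ι a).Ω (fun x μ => Jcur (ι a).η U₀ A' μ x)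
        + wsup 1 (fun p : {p : ℕ × (Site d × Fin d) // p.1 ≤ m ∧ p.2 ∈ towerBondsP L (ι a).Ω ((ι a).Λs m) p.1} =>
        linCovIter L U₀ (iEta (ι a).η A') p.1.1 p.1.2.1 p.1.2.2)) + γ' * B₀ * (α₀ + α₁)))
    (SP5u : ∀ a : J, ∀ α₀ α₁ : ℝ, 0 < α₀ → 0 < α₁ → α₀ + α₁ ≤ cP →
      ∀ U₀ U' : Site d → Fin d → 𝔸ˣ, (∀ x κ, U₀ x κ ∈ unitaryUnits 𝔸) → (∀ x κ, U' x κ ∈ unitaryUnits 𝔸) →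
      ∀ φ : Site d → 𝔸, ((InR138 L (ι a).k (ι a).η ((ι a).Ω 0) ((ι a).Λs (ι a).k) U₀ φ ∧ (∀ x, IsSelfAdjoint (φ x)) ∧ (∀ x, x ∉ (ι a).Ω 0 → φ x = 0) ∧
          Bdd L (ι a).k (ι a).η (-(2 : ℝ)) (fun j (x : Site d) => x ∈ (ι a).Ω j) φ) ∧
        msup L (ι a).k (ι a).η (-(2 : ℝ)) (fun j (x : Site d) => x ∈ (ι a).Ω j) φ < γ * (α₀ + α₁)) →
      InAk L (ι a).k (ι a).η α₀ (ι a).Ω U₀ → InAk L (ι a).k (ι a).η α₀ (ι a).Ω (mulCfg U' U₀) → (∀ m, m ≤ (ι a).k → InAx L m ((ι a).Λs m) U₀ (mulCfg U' U₀)) →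
      (∀ j, j ≤ (ι a).k → ∀ (z : Site d) (μ : Fin d),
        ((∀ x, InBox (tlo L z j) (thi L z j) x → x ∈ (ι a).Ω j) ∨ (∀ x, InBox (tlo L (z + e μ) j) (thi L (z + e μ) j) x → x ∈ (ι a).Ω j)) →
        ‖(avgIter L (mulCfg U' U₀) j z μ : 𝔸) - (avgIter L U₀ j z μ : 𝔸)‖ ≤ α₁) →
      (∀ b ∈ {b : Site d × Fin d | SideTouches ((ι a).Ω 0) b.1 b.2}, ‖((U' b.1 b.2 : 𝔸ˣ) : 𝔸) - 1‖ ≤ α₁) →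
      ∀ u₁ : Site d → 𝔸ˣ, (∀ x, u₁ x ∈ unitaryUnits 𝔸) → (∀ x, x ∉ (ι a).Ω 0 → u₁ x = 1) → Restr129 L (ι a).k ((ι a).Λs (ι a).k) U₀ u₁ →
      LanF a U₀ φ (ι a).k (mgauge U₀ u₁⁻¹ U') →
      (∃ A₁ : Site d → Fin d → 𝔸, ∀ j, j ≤ (ι a).k → ∀ (x : Site d) (κ : Fin d), SideTouches ((ι a).Ω j) x κ →
        mgauge U₀ u₁⁻¹ U' x κ = cfgExp (ι a).η A₁ x κ ∧ ‖A₁ x κ‖ ≤ (5 * (d : ℝ) * L * B₈ * (α₀ + α₁)) * ((L : ℝ) ^ j * (ι a).η)⁻¹) →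
      ∀ (v w : Site d → 𝔸ˣ) (lam mu : Site d → 𝔸),
      (∀ x, ((gaugeExp lam x : 𝔸ˣ) : 𝔸) = ((v x : 𝔸ˣ) : 𝔸) ∧ IsSelfAdjoint (lam x) ∧ ‖lam x‖ < cu) → (∀ x, x ∉ (ι a).Ω 0 → lam x = 0) →
      (∀ j, j ≤ (ι a).k → ∀ b ∈ {b : Site d × Fin d | SideTouches ((ι a).Ω j) b.1 b.2}, ((L : ℝ) ^ j * (ι a).η) * ‖covDerivFwd (ι a).η U₀ b.2 lam b.1‖ < cu) →
      (∀ x, ((gaugeExp mu x : 𝔸ˣ) : 𝔸) = ((w x : 𝔸ˣ) : 𝔸) ∧ IsSelfAdjoint (mu x) ∧ ‖mu x‖ < cu) → (∀ x, x ∉ (ι a).Ω 0 → mu x = 0) →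
      (∀ j, j ≤ (ι a).k → ∀ b ∈ {b : Site d × Fin d | SideTouches ((ι a).Ω j) b.1 b.2}, ((L : ℝ) ^ j * (ι a).η) * ‖covDerivFwd (ι a).η U₀ b.2 mu b.1‖ < cu) →
      LanF a U₀ φ (ι a).k (mgauge U₀ v⁻¹ (mgauge U₀ u₁⁻¹ U')) → Restr129 L (ι a).k ((ι a).Λs (ι a).k) U₀ (u₁ * v) →
      LanF a U₀ φ (ι a).k (mgauge U₀ w⁻¹ (mgauge U₀ u₁⁻¹ U')) → Restr129 L (ι a).k ((ι a).Λs (ι a).k) U₀ (u₁ * w) →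
      ∀ x, v x = w x)
    (SP3src : ∀ a : J, ∀ α₀ α₁ α₂ : ℝ, 0 < α₀ → α₀ ≤ cP3 → 0 < α₁ → α₁ ≤ cP3 → 0 < α₂ → α₂ ≤ cP3 →
      2 * α₂ ^ 2 + 20 * d * α₀ * α₂ + 2 * (2097152 * ((d : ℝ) + 1) ^ 2 * (L : ℝ) ^ 2) * α₂ ^ 2 ≤ α₀ + α₁ →
      ∀ (U₀ : (zdGF3HP₂ 𝔸 L β len (ι a)).Cfg) (P' : (zdGF3HP₂ 𝔸 L β len (ι a)).Pert) (f : Site d → 𝔸),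
        (zdGF3HP₂ 𝔸 L β len (ι a)).InR U₀ f → (zdGF3HP₂ 𝔸 L β len (ι a)).fNorm f < γ * (α₀ + α₁) → (zdGF3HP₂ 𝔸 L β len (ι a)).fGrad U₀ f < γ * (α₀ + α₁) →
        (zdGF3HP₂ 𝔸 L β len (ι a)).InA α₀ U₀ → (zdGF3HP₂ 𝔸 L β len (ι a)).InAPair α₀ U₀ P' → (zdGF3HP₂ 𝔸 L β len (ι a)).C162 1 α₂ U₀ P' →
        (zdGF3HP₂ 𝔸 L β len (ι a)).LandauF U₀ f P' → (zdGF3HP₂ 𝔸 L β len (ι a)).C137 α₁ U₀ P' →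
        (zdGF3HP₂ 𝔸 L β len (ι a)).C136 (5 * d * L * B₈) (5 * d * L * B₀β) (α₀ + α₁) U₀ P' ∧
          (zdGF3HP₂ 𝔸 L β len (ι a)).C139 (5 * d * L * B₈) (α₀ + α₁) U₀ P') :
    B8Thm8Surviving.Thm8SurvivingAt γ (5 * (d : ℝ) * L * B₈ * (1 + 11 * (d : ℝ) ^ 2)) (5 * (d : ℝ) * L * B₀β * (1 + 11 * (d : ℝ) ^ 2))
      (fun a : J => zdGF3HP₂ 𝔸 L β len (ι a)) := by
  have hL1 : 1 ≤ L := le_trans (by norm_num) hL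
  have hd1 : 1 ≤ d := le_trans (by norm_num) hd2
  have hL' : (1 : ℝ) ≤ L := by exact_mod_cast hL1
  have hd' : (1 : ℝ) ≤ d := by exact_mod_cast hd1
  -- the Theorem-4-shaped core at the source-indexed gauge predicate, the windows
  obtain ⟨c4, hc4, H4⟩ := thm4Core_zdGF3HP_map_lanE_γ' (𝔸 := 𝔸) (β := β) (len := len) hd2 hL hB₀ hB₀' hcu hcP (Φ := Site d → 𝔸) hγ' hB₈ hB₀8 hB
    hγB ι (fun a f U₀ a0 b0 => (InR138 L (ι a).k (ι a).η ((ι a).Ω 0) ((ι a).Λs (ι a).k) U₀ f ∧ (∀ x, IsSelfAdjoint (f x)) ∧ (∀ x, x ∉ (ι a).Ω 0 → f x = 0) ∧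
        Bdd L (ι a).k (ι a).η (-(2 : ℝ)) (fun j (x : Site d) => x ∈ (ι a).Ω j) f) ∧
      msup L (ι a).k (ι a).η (-(2 : ℝ)) (fun j (x : Site d) => x ∈ (ι a).Ω j) f < γ * (a0 + b0)) LanF SP5base SP5 SH59src SP5u
  obtain ⟨cw, hcw, hw⟩ := thm4_windows hd1 hL1 hB₈ hB₀' hB
  obtain ⟨cw', hcw', hw'⟩ := thm4_windows_extra (d := d) hL1
  obtain ⟨cγ, hcγ, hwγ⟩ := thm4_windows_γ hd1 hL1 hB₈ hB₀' hB
  -- constants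
  set D : ℝ := 1 + 11 * (d : ℝ) ^ 2 with hD_def
  have hD1 : 1 ≤ D := le_add_of_nonneg_right (by positivity)
  have hD0 : 0 < D := lt_of_lt_of_le one_pos hD1
  have hDne : D ≠ 0 := hD0.ne'
  have hK₁ : 0 < 5 * (d : ℝ) * L * B₈ := by positivity
  have hK₁D : 0 < 5 * (d : ℝ) * L * B₈ * D := mul_pos hK₁ hD0
  -- the threshold
  set cT : ℝ := min (min (min (c4 / D) (cγ / D)) (min (cw / D) (cw' / D)))
    (min (min (cP3 / D) (cP3 / (5 * (d : ℝ) * L * B₈ * D))) (1 / (6 * D))) with hcT_def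
  have hcT : 0 < cT :=
    lt_min (lt_min (lt_min (div_pos hc4 hD0) (div_pos hcγ hD0)) (lt_min (div_pos hcw hD0) (div_pos hcw' hD0)))
      (lt_min (lt_min (div_pos hcP3 hD0) (div_pos hcP3 hK₁D)) (by positivity))
  refine ⟨cT, hcT, ?_⟩
  intro a α₀ α₁ hα₀ hα₁ hs U₀ P f hInA hReg hInAAx havg hInR hf
  have hS0 : 0 < α₀ + α₁ := add_pos hα₀ hα₁
  -- unpack the thresholds
  have hle : ∀ {c : ℝ}, cT ≤ c / D → D * (α₀ + α₁) ≤ c := by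
    intro c hc
    have h1 : α₀ + α₁ ≤ c / D := hs.trans hc
    calc D * (α₀ + α₁) ≤ D * (c / D) := mul_le_mul_of_nonneg_left h1 hD0.le
      _ = c := by field_simp
  have hs4 : D * (α₀ + α₁) ≤ c4 := hle ((min_le_left _ _).trans ((min_le_left _ _).trans (min_le_left _ _)))
  have hsγ : D * (α₀ + α₁) ≤ cγ := hle ((min_le_left _ _).trans ((min_le_left _ _).trans (min_le_right _ _)))
  have hsw : D * (α₀ + α₁) ≤ cw := hle ((min_le_left _ _).trans ((min_le_right _ _).trans (min_le_left _ _)))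
  have hsw' : D * (α₀ + α₁) ≤ cw' := hle ((min_le_left _ _).trans ((min_le_right _ _).trans (min_le_right _ _)))
  have hs3 : D * (α₀ + α₁) ≤ cP3 := hle ((min_le_right _ _).trans ((min_le_left _ _).trans (min_le_left _ _)))
  have hs3' : 5 * (d : ℝ) * L * B₈ * D * (α₀ + α₁) ≤ cP3 := by
    have h1 : α₀ + α₁ ≤ cP3 / (5 * (d : ℝ) * L * B₈ * D) :=
      hs.trans ((min_le_right _ _).trans ((min_le_left _ _).trans (min_le_right _ _)))
    calc 5 * (d : ℝ) * L * B₈ * D * (α₀ + α₁) ≤ 5 * (d : ℝ) * L * B₈ * D * (cP3 / (5 * (d : ℝ) * L * B₈ * D)) :=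
        mul_le_mul_of_nonneg_left h1 hK₁D.le
      _ = cP3 := by field_simp
  have hs6 : D * (α₀ + α₁) ≤ 1 / 6 := by
    have h1 : α₀ + α₁ ≤ 1 / (6 * D) := hs.trans ((min_le_right _ _).trans (min_le_right _ _))
    calc D * (α₀ + α₁) ≤ D * (1 / (6 * D)) := mul_le_mul_of_nonneg_left h1 hD0.le
      _ = 1 / 6 := by field_simp
  -- the shifted pair `(α₀, α″)`
  set α'' : ℝ := 11 * (d : ℝ) ^ 2 * (α₀ + α₁) + α₁ with hα''_def
  have h11 : 0 ≤ 11 * (d : ℝ) ^ 2 * (α₀ + α₁) := by positivity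
  have h11' : 0 ≤ 11 * (d : ℝ) ^ 2 * α₁ := by positivity
  have hα'' : 0 < α'' := by rw [hα''_def]; linarith only [h11, hα₁]
  have hsum : α₀ + α'' = D * (α₀ + α₁) := by simp only [hα''_def, hD_def]; ring
  have hα₁'' : α₁ ≤ α'' := by rw [hα''_def]; linarith only [h11]
  have h165 : 11 * (d : ℝ) ^ 2 * α₀ + α₁ ≤ α'' := by rw [hα''_def]; linarith only [h11']
  have hSS : α₀ + α₁ ≤ α₀ + α'' := by linarith only [hα₁'']
  -- windows at the shifted pair
  obtain ⟨-, -, -, -, w5, w6, w7, -, -, -, -, -, -, -, -, -, -, -⟩ :=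
    hw α₀ α'' hα₀ hα'' (hsum ▸ hsw) (5 * (d : ℝ) * L * B₈ * (α₀ + α'')) (8 * B₀' * (5 * (d : ℝ) * L * B₈) * (α₀ + α'')) rfl rfl
  obtain ⟨w19, -⟩ := hw' α₀ α'' hα₀ hα'' (hsum ▸ hsw')
  -- the γ windows at the shifted pair ([3] Prop. 4 at `(L²α₀, L·α₂)`; (1.61) with `C₂ = 2097152(d+1)²L²`)
  obtain ⟨g3, g4, g16, gsmall, gc₃, -, g61⟩ :=
    hwγ α₀ α'' hα₀ hα'' (hsum ▸ hsγ) (5 * (d : ℝ) * L * B₈ * (α₀ + α'')) (8 * B₀' * (5 * (d : ℝ) * L * B₈) * (α₀ + α'')) rfl rfl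
  have hsmall₁ : (d : ℝ) * L * α₁ ≤ 1 / 8 := (mul_le_mul_of_nonneg_left hα₁'' (by positivity)).trans w19
  have hα2 : 2 * α₀ ≤ c2' d L := by linarith only [w6, hα₀]
  -- the data
  obtain ⟨hP1, h34, hAx⟩ := hInAAx
  subst hP1
  -- (1.66)₀ on all bonds (Ω₀ = ℤᵈ): (1.65)
  have hpart' : ∀ x : Site d, ∃ j, j ≤ (ι a).k ∧ ∃ y ∈ (ι a).Λs (ι a).k j, InBox (tlo L y j) (thi L y j) x := by
    intro x
    have hx : x ∈ (ι a).Ω 0 := by rw [hΩ0 a]; trivial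
    exact (ι a).hpart x hx
  have hsm : 11 * (d : ℝ) ^ 2 * α₀ + α₁ ≤ 1 / 6 := by linarith only [h165, hα₀, hsum, hs6]
  -- the P-carrier's (1.35) letter (one-end-point class) CONTAINS the box form `B8Ineq166Univ` reads (`endBlockIn_of_box`)
  have havgB : ∀ j, j ≤ (ι a).k → ∀ (z : Site d) (μ : Fin d), (∀ x, InBox (loK L j z) (bondHiK L j z μ) x → x ∈ (ι a).Ω j) →
      ‖(avgIter L (mulCfg P.2.1 P.1.1) j z μ : 𝔸) - (avgIter L P.1.1 j z μ : 𝔸)‖ ≤ α₁ :=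
    fun j hj z μ hbox => havg j hj z μ (B8LeafModelZd3P.endBlockIn_of_box L ((ι a).Ω j) j z μ hbox)
  have h66 : ∀ b ∈ {b : Site d × Fin d | SideTouches ((ι a).Ω 0) b.1 b.2}, ‖((P.2.1 b.1 b.2 : 𝔸ˣ) : 𝔸) - 1‖ ≤ α'' := by
    intro b _
    have h := norm_pert_sub_one_le_univ hd1 hL (ι a).k (η := (ι a).η) P.1.2 P.2.2 hα₀ w5 hα2 hα₁.le hsm
      (ι a).Ω (ι a).hΩ ((ι a).Λs (ι a).k) (ι a).htower hpart' hInA h34 (hAx (ι a).k le_rfl) havgB b.1 b.2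
    exact h.trans h165
  have h166 : (zdGF3HP₂ 𝔸 L β len (ι a)).avgClose166 α'' P.1 P :=
    ⟨fun j hj z μ hb => (havg j hj z μ hb).trans hα₁'', h66⟩
  -- the source is admitted at the shifted pair
  have hfS : msup L (ι a).k (ι a).η (-(2 : ℝ)) (fun j (x : Site d) => x ∈ (ι a).Ω j) f < γ * (α₀ + α'') :=
    lt_of_lt_of_le hf (mul_le_mul_of_nonneg_left hSS hγ.le)
  -- THE THEOREM-4-SHAPED CORE at the shifted pair
  obtain ⟨u, hR, ⟨h137'', hLan, h162⟩, huniq⟩ :=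
    H4 a (htw a) α₀ α'' hα₀ hα'' (hsum ▸ hs4) P.1 P f ⟨hInR, hfS⟩ hInA ⟨rfl, h34, hAx⟩ h166
  have hLF : (zdGF3HP₂ 𝔸 L β len (ι a)).LandauF P.1 f ((zdGF3HP₂ 𝔸 L β len (ι a)).act P u) := (hLanF a P.1.1 f _).1 hLan
  have hcs0 : 0 ≤ 5 * (d : ℝ) * L * B₈ * (α₀ + α'') := by positivity
  -- PROPOSITION 3 WITH SOURCE at (α₀, α″, α₂ := c⋆″) for the gauge-fixed field (socket), under the inspected size
  have hSD : α₀ + α₁ ≤ D * (α₀ + α₁) := le_mul_of_one_le_left hS0.le hD1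
  have hα₀3 : α₀ ≤ cP3 := by linarith only [hα₁, hSD, hs3]
  have hα''3 : α'' ≤ cP3 := by linarith only [hα₀, hsum, hs3]
  have hcs3 : 5 * (d : ℝ) * L * B₈ * (α₀ + α'') ≤ cP3 := by
    rw [hsum, ← mul_assoc]; exact hs3'
  have hcspos : 0 < 5 * (d : ℝ) * L * B₈ * (α₀ + α'') := by positivity
  have hKS0 : 0 ≤ 2 * (L * (5 * (d : ℝ) * L * B₈ * (α₀ + α''))) + 8 * (8 * B₀' * (5 * (d : ℝ) * L * B₈) * (α₀ + α'')) := by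
    positivity
  have hcK : 5 * (d : ℝ) * L * B₈ * (α₀ + α'') ≤
      2 * (L * (5 * (d : ℝ) * L * B₈ * (α₀ + α''))) + 8 * (8 * B₀' * (5 * (d : ℝ) * L * B₈) * (α₀ + α'')) := by
    have h₁ : (1 : ℝ) * (5 * (d : ℝ) * L * B₈ * (α₀ + α'')) ≤ L * (5 * (d : ℝ) * L * B₈ * (α₀ + α'')) :=
      mul_le_mul_of_nonneg_right hL' hcs0
    have h₂ : 0 ≤ 8 * (8 * B₀' * (5 * (d : ℝ) * L * B₈) * (α₀ + α'')) := by positivity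
    linarith only [h₁, h₂, hcs0]
  have h61 : 2 * (5 * (d : ℝ) * L * B₈ * (α₀ + α'')) ^ 2 + 20 * d * α₀ * (5 * (d : ℝ) * L * B₈ * (α₀ + α'')) +
      2 * (2097152 * ((d : ℝ) + 1) ^ 2 * (L : ℝ) ^ 2) * (5 * (d : ℝ) * L * B₈ * (α₀ + α'')) ^ 2 ≤ α₀ + α'' := by
    set c := 5 * (d : ℝ) * L * B₈ * (α₀ + α'') with hc
    set K := 2 * (L * c) + 8 * (8 * B₀' * (5 * (d : ℝ) * L * B₈) * (α₀ + α'')) with hK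
    have hcKle : c ≤ K := hcK
    have hc0 : 0 ≤ c := hcs0
    have hC : (2 : ℝ) * (16 * (131072 * ((d : ℝ) + 1) ^ 2) * (L : ℝ) ^ 2) = 2 * (2097152 * ((d : ℝ) + 1) ^ 2 * (L : ℝ) ^ 2) := by ring
    rw [← hC]
    have hmono : 2 * c ^ 2 + 20 * d * α₀ * c + 2 * (16 * (131072 * ((d : ℝ) + 1) ^ 2) * (L : ℝ) ^ 2) * c ^ 2 ≤
        2 * K ^ 2 + 20 * d * α₀ * K + 2 * (16 * (131072 * ((d : ℝ) + 1) ^ 2) * (L : ℝ) ^ 2) * K ^ 2 := by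
      have h1 : c ^ 2 ≤ K ^ 2 := pow_le_pow_left₀ hc0 hcKle 2
      have h2 : 0 ≤ 20 * (d : ℝ) * α₀ := by positivity
      have h3 : 0 ≤ 2 * (16 * (131072 * ((d : ℝ) + 1) ^ 2) * (L : ℝ) ^ 2) := by positivity
      have h4 := mul_le_mul_of_nonneg_left hcKle h2
      have h5 := mul_le_mul_of_nonneg_left h1 h3
      linarith only [h1, h4, h5]
    exact hmono.trans g61
  have hu : ∀ x, u.1 x ∈ unitaryUnits 𝔸 := u.2.1
  have hW : mgauge P.1.1 u.1 (mgauge P.1.1 u.1⁻¹ P.2.1) = P.2.1 := B8Thm4AtLandau138.mgauge_mgauge_inv P.1.1 P.2.1 u.1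
  -- (1.37) at the ORIGINAL `α₁`: the (1.42) lemma on the canonical exponent of the gauge-fixed field (as in `thm2Printed_zd3_univ`)
  have hc16 : 16 * (5 * (d : ℝ) * L * B₈ * (α₀ + α'')) ≤ 1 := by linarith only [w7, hcK, hKS0]
  have hWu : ∀ x κ, mgauge P.1.1 u.1⁻¹ P.2.1 x κ ∈ unitaryUnits 𝔸 :=
    B8Prop3GaugeFixedKLevel.mem_unitaryUnits_of_mgauge_eq P.1.2 P.2.2 hu hW
  have hWA : ∀ j, j ≤ (ι a).k → ∀ y τ, SideTouches ((ι a).Ω j) y τ →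
      mgauge P.1.1 u.1⁻¹ P.2.1 y τ = cfgExp (ι a).η (logCfg (ι a).η (mgauge P.1.1 u.1⁻¹ P.2.1)) y τ ∧
        ‖logCfg (ι a).η (mgauge P.1.1 u.1⁻¹ P.2.1) y τ‖ ≤ (5 * (d : ℝ) * L * B₈ * (α₀ + α'')) * ((L : ℝ) ^ j * (ι a).η)⁻¹ :=
    fun j hj y τ h => ⟨(h162 j hj (y, τ) h).1, (h162 j hj (y, τ) h).2.2⟩
  obtain ⟨hA'sa, hA'eq, hA'zero⟩ := B8LeafModelZd3.mlogCfg_spec (ι a).hη hL1 (ι a).k P.1.1 hWu hcs0 hc16 (ι a).Ω hWA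
  set A' := B8LeafModelZd3.mlogCfg (ι a).k (ι a).η (ι a).Ω (mgauge P.1.1 u.1⁻¹ P.2.1) with hA'_def
  have hA'bd : ∀ j, j ≤ (ι a).k → ∀ y τ, SideTouches ((ι a).Ω j) y τ →
      mgauge P.1.1 u.1⁻¹ P.2.1 y τ = cfgExp (ι a).η A' y τ ∧
        ‖A' y τ‖ ≤ (2 * (L * (5 * (d : ℝ) * L * B₈ * (α₀ + α''))) + 8 * (8 * B₀' * (5 * (d : ℝ) * L * B₈) * (α₀ + α''))) *
          ((L : ℝ) ^ j * (ι a).η)⁻¹ := by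
    intro j hj y τ h
    obtain ⟨hAA, hWexp⟩ := hA'eq j hj y τ h
    refine ⟨hWexp, ?_⟩
    rw [hAA]
    have hη0 : 0 ≤ (ι a).η := (ι a).hη.le
    exact ((hWA j hj y τ h).2).trans (mul_le_mul_of_nonneg_right hcK (by positivity))
  have h137 : (zdGF3HP₂ 𝔸 L β len (ι a)).C137 α₁ P.1 ((zdGF3HP₂ 𝔸 L β len (ι a)).act P u) :=
    B8Eq142KLevelLocalGammaPrime.H42_of_inAx_γ' hd2 (ι a).hη hL (ι a).k P.1.2 hα₀ hα₁ hKS0 g3 g4 g16 gsmall gc₃ hsmall₁ (ι a).Ω (ι a).hΩ (ι a).Λs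
      (fun m j => towerBondsP L (ι a).Ω ((ι a).Λs m) j) (B8TowerBondsPrinted.ZdIdx.towerBondsP_laws (ι a)).1
      (B8TowerBondsPrinted.ZdIdx.towerBondsP_laws (ι a)).2 hInA h34 hAx havg (fun m W => LanF a P.1.1 f m W) (ι a).k (ι a).hk le_rfl
      (htw a (ι a).k le_rfl) u.1 (mgauge P.1.1 u.1⁻¹ P.2.1) A' hu hW hR hLan hA'sa hA'bd hA'zero
  have hPair : (zdGF3HP₂ 𝔸 L β len (ι a)).InAPair α₀ P.1 ((zdGF3HP₂ 𝔸 L β len (ι a)).act P u) := by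
    show InAk L (ι a).k (ι a).η α₀ (ι a).Ω (mulCfg (mgauge P.1.1 u.1⁻¹ P.2.1) P.1.1)
    have hui : ∀ x, u.1⁻¹ x ∈ U1 𝔸 := fun x => unitaryUnits_le_U1 ((unitaryUnits 𝔸).inv_mem (hu x))
    rw [B8Prop3GaugeFixedKLevel.mulCfg_eq_gaugeAct_of_mgauge_eq hW]
    exact (B8Ineq132.inAk_gaugeAct_iff L (ι a).k (ι a).η α₀ (ι a).Ω hui _).2 h34
  have h162' : (zdGF3HP₂ 𝔸 L β len (ι a)).C162 1 (5 * (d : ℝ) * L * B₈ * (α₀ + α'')) P.1 ((zdGF3HP₂ 𝔸 L β len (ι a)).act P u) := by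
    intro j hj b hb
    obtain ⟨h1, h2, h3⟩ := h162 j hj b hb
    exact ⟨h1, h2, by rw [one_mul]; exact h3⟩
  -- constants: `5dLB₈(α₀ + α″) = B₁(α₀ + α₁)`, `5dL·B₀β·(α₀ + α″) = B₂(α₀ + α₁)`
  have e1 : 5 * (d : ℝ) * (L : ℝ) * B₈ * (α₀ + α'') = 5 * (d : ℝ) * L * B₈ * (1 + 11 * (d : ℝ) ^ 2) * (α₀ + α₁) := by
    rw [hsum, hD_def]; ring
  have e2 : 5 * (d : ℝ) * (L : ℝ) * B₀β * (α₀ + α'') = 5 * (d : ℝ) * L * B₀β * (1 + 11 * (d : ℝ) ^ 2) * (α₀ + α₁) := by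
    rw [hsum, hD_def]; ring
  refine ⟨u, hR, ⟨fun j hj b hb => ?_, ?_, hLF, fun hgrad => ?_⟩, ?_⟩
  · -- (1.62)-shape at `B₁(α₀ + α₁)`
    obtain ⟨h1, h2, h3⟩ := h162 j hj b hb
    exact ⟨h1, h2, by rw [← e1]; exact h3⟩
  · exact h137
  · -- the conditional (1.36) ∧ (1.39) from the SOURCED Proposition 3 at (α₀, α″, c⋆″)
    have hgrad'' : (zdGF3HP₂ 𝔸 L β len (ι a)).fGrad P.1 f < γ * (α₀ + α'') := lt_of_lt_of_le hgrad (mul_le_mul_of_nonneg_left hSS hγ.le)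
    obtain ⟨h136, h139⟩ := SP3src a α₀ α'' (5 * (d : ℝ) * L * B₈ * (α₀ + α'')) hα₀ hα₀3 hα'' hα''3 hcspos hcs3 h61 P.1
      ((zdGF3HP₂ 𝔸 L β len (ι a)).act P u) f hInR hfS hgrad'' hInA hPair h162' hLF h137''
    obtain ⟨h136a, h136g, h136h⟩ := h136
    obtain ⟨h139j, h139l⟩ := h139
    refine ⟨⟨fun j hj b hb => ?_, by rw [← e1]; exact h136g, by rw [← e2]; exact h136h⟩,
      ⟨by rw [← e1]; exact h139j, by rw [← e1]; exact h139l⟩⟩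
    obtain ⟨h1, h2, h3⟩ := h136a j hj b hb
    exact ⟨h1, h2, by rw [← e1]; exact h3⟩
  -- uniqueness: the core's, since (1.36) at `B₁(α₀ + α₁) = 5dLB₈(α₀ + α″)` is the (1.62)-shape there
  · intro u' hR' h136' _ _ hLanF'
    refine huniq u' hR' ((hLanF a P.1.1 f _).2 hLanF') ?_
    intro j hj b hb
    obtain ⟨h1, h2, h3⟩ := h136'.1 j hj b hb
    refine ⟨h1, h2, ?_⟩
    rw [e1]
    exact h3

end Thm8


end Literature.MathematicalPhysics.QuantumFieldTheory.Balaban1983to89.B8Thm8SurvivingZdGF3HP2MapLanEGamma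

end
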